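import Summits.ResolutionOfSingularities.ResolutionOfSingularities.Theorems.PurelyInseparableDim4ChartAtlasAlgebra
import HarnessLib

/-!
# Purely inseparable four-folds `z^p + F(x₁, …, x₄)`: the escaping global centre INSIDE the exceptional divisor, read on
# the other charts — ring level (brick S3-N1 «atlas of an escaping global centre», part E5, case `j ∈ S'`; cell
# `res-dim4-pi`, typ-2 g5)

[OURS · counted 0] (D-0157 DOOR 2; DR-157-C; desk WORD #115 (a) (S3-N1); typ-3 g4 `S3c-V3-DESIGN.md` addendum (b) «escaping
children INSIDE `E_j` (`j ∈ S″`, `S ⊄ S″`): atlas members (several charts)»; frame `PIDim4.TerminationImpliesOrderReduction`,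
S3 (c)). Setting of typ-2 g4's A3/C1 (`…ChartClosureIdealInside`, `…ChartClosureInside`): the next centre `S'` CONTAINS the
chart index `j`; `S″ = S' ∖ {j}`; `J″` the graph ideal of A2 for `S″` (lift `H` of `S'`); the global centre `Zc` is an
irreducible component of `V(St_π(𝒥″) + 𝓘_{E₁})`, and on the `x_j`-chart `Θⱼ(J″^{st,j}) + (x_j) = (z, x_{S'})`. THIS FILE: the
same on the `x_l`-chart, `l ∈ S ∖ S'` — where the exceptional divisor is `x_l = 0`, so the centre read there is
`V(z, x_{S″}, x_l)`, index set `insert l S″`. With E1's shear `Ξ` (`Ξ z = z + τ H_l`, `Ξ|_{K[x]} = τ`) followed by a cleaning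
`θ` (`θ z = z + δ`, `θ x = x`) whose root `δ` lies in `(x_k : k ∈ insert l S″)`, PROVED here (no `sorry`, no new axiom):

* §1 `map_clean_IΛ_sup_span_X` — `θ(z, x_{S″}) + (x_l) = (z, x_{S″}, x_l)` for such `θ`;
* §2 **`map_shear_clean_coordStrictTransformIdeal_graph_sup`** — `(θ ∘ Ξ)(J″^{st,l}) + (x_l) = (z, x_{insert l S″})`: on the
  re-centred `x_l`-chart the strict transform of `Y″` MEETS THE EXCEPTIONAL DIVISOR `x_l = 0` exactly in the coordinate
  subspace `V(z, x_{S″}, x_l)`;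
* §3 `trans_clean_X_zero`, `trans_clean_X_succ` — the composite `Ξ.trans θ` is again a shear re-centring of E1's shape
  (`z ↦ z + (τ H_l + δ)`, `x ↦ τ x`), so E2's transform reading applies to it verbatim;
* §4 `X_succ_add_C_not_mem_IΛ` — `x_l + c ∉ (z, x_{S'})` for `l ∉ S'` (the generic point of the re-centred chart-`j` image
  lies in the `x_l`-chart; used by the sequel for `Zc ∩ W[⊤, x_l] ≠ ∅`).

HONEST SCOPE: ring identities only; sheaf level, cover and package for `j ∈ S'` are the sequels E6/E7. Nothing here is a
statement about resolution of singularities in dimension ≥ 4 / characteristic `p` (NOT proved anywhere in this programme).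
bears_on: LADDER-RESOLUTION:D157-DOOR2 (res-dim4-pi). Supports stmt-ResolutionOfSingularities-16155 (helper, S3-N1 E5).
-/

-- every declaration of this summit lives under `Summit.ResolutionOfSingularities.ResolutionOfSingularities`
-- (summit = problem), which the duplicate-namespace linter flags; house convention (cf. the Target file).
set_option linter.dupNamespace false

noncomputable section

open MvPolynomial Finset

namespace Summit.ResolutionOfSingularities.ResolutionOfSingularities.Theorems.PIDim4

open Literature.AlgebraicGeometry.Resolution
open Literature.AlgebraicGeometry.Resolution.AffinePointBlowup (A)

namespace ChartDictionary

variable {K : Type} [Field K] {S S'' : Finset (Fin 4)} {j l : Fin 4} {b : Fin 4 → K}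
  {Ξ θ : A 4 K ≃ₐ[K] A 4 K} {τ : MvPolynomial (Fin 4) K ≃ₐ[K] MvPolynomial (Fin 4) K}
  {δ g₀ : MvPolynomial (Fin 4) K}

/-! ## §1 A cleaning with root in `(x_{insert l S″})` moves `(z, x_{S″})` inside `(z, x_{S″}, x_l)` -/

/-- **`θ(z, x_{S″}) + (x_l) = (z, x_{S″}, x_l)`** for a cleaning automorphism `θ` (`θ z = z + δ`, `θ x = x`) whose root `δ`
lies in `(x_k : k ∈ insert l S″)`. -/
theorem map_clean_IΛ_sup_span_X (hθ0 : θ (X 0) = X 0 + rename Fin.succ δ) (hθs : ∀ i : Fin 4, θ (X i.succ) = X i.succ)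
    (hδ : δ ∈ Ideal.span (X '' ((insert l S'' : Finset (Fin 4)) : Set (Fin 4)) : Set (MvPolynomial (Fin 4) K))) :
    (AffineCoordBlowup.IΛ 4 K (insert 0 (Fin.succ '' (S'' : Set (Fin 4))))).map (θ : A 4 K →+* A 4 K) ⊔
        Ideal.span {(X l.succ : A 4 K)} =
      AffineCoordBlowup.IΛ 4 K (insert 0 (Fin.succ '' ((insert l S'' : Finset (Fin 4)) : Set (Fin 4)))) := by
  set T : Finset (Fin 4) := insert l S'' with hT
  have hδ' : rename Fin.succ δ ∈ AffineCoordBlowup.IΛ 4 K (insert 0 (Fin.succ '' (T : Set (Fin 4)))) :=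
    rename_mem_IΛ_of_mem_span hδ
  apply le_antisymm
  · refine sup_le ?_ ?_
    · rw [AffineCoordBlowup.IΛ, Ideal.map_span, Ideal.span_le]
      rintro _ ⟨_, ⟨m, hm, rfl⟩, rfl⟩
      rcases hm with rfl | ⟨k, hk, rfl⟩
      · rw [SetLike.mem_coe, RingHom.coe_coe, hθ0]
        exact Ideal.add_mem _ (Ideal.subset_span ⟨0, Set.mem_insert _ _, rfl⟩) hδ'
      · rw [SetLike.mem_coe, RingHom.coe_coe, hθs k]
        exact Ideal.subset_span ⟨k.succ, Set.mem_insert_of_mem _ ⟨k, Finset.mem_coe.mpr (Finset.mem_insert_of_mem hk), rfl⟩,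
          rfl⟩
    · rw [Ideal.span_singleton_le_iff_mem]
      exact Ideal.subset_span ⟨l.succ, Set.mem_insert_of_mem _ ⟨l, Finset.mem_coe.mpr (Finset.mem_insert_self l _), rfl⟩, rfl⟩
  · -- the `x`-generators of `(z, x_T)` lie in the left side, hence `rename δ`, hence `z = θ z − rename δ`
    have hx : ∀ k ∈ T, (X k.succ : A 4 K) ∈
        (AffineCoordBlowup.IΛ 4 K (insert 0 (Fin.succ '' (S'' : Set (Fin 4))))).map (θ : A 4 K →+* A 4 K) ⊔
          Ideal.span {(X l.succ : A 4 K)} := by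
      intro k hk
      rcases Finset.mem_insert.mp hk with rfl | hk
      · exact Ideal.mem_sup_right (Ideal.subset_span rfl)
      · refine Ideal.mem_sup_left ?_
        have h1 := Ideal.mem_map_of_mem (θ : A 4 K →+* A 4 K)
          (Ideal.subset_span ⟨k.succ, Set.mem_insert_of_mem _ ⟨k, Finset.mem_coe.mpr hk, rfl⟩, rfl⟩ :
            (X k.succ : A 4 K) ∈ AffineCoordBlowup.IΛ 4 K (insert 0 (Fin.succ '' (S'' : Set (Fin 4)))))
        rwa [RingHom.coe_coe, hθs k] at h1
    have hδ'' : rename Fin.succ δ ∈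
        (AffineCoordBlowup.IΛ 4 K (insert 0 (Fin.succ '' (S'' : Set (Fin 4))))).map (θ : A 4 K →+* A 4 K) ⊔
          Ideal.span {(X l.succ : A 4 K)} := by
      have h4 := Ideal.mem_map_of_mem (rename Fin.succ : MvPolynomial (Fin 4) K →ₐ[K] A 4 K).toRingHom hδ
      rw [Ideal.map_span] at h4
      refine (Ideal.span_le.mpr ?_) h4
      rintro _ ⟨_, ⟨k, hk, rfl⟩, rfl⟩
      rw [SetLike.mem_coe, AlgHom.toRingHom_eq_coe, RingHom.coe_coe, rename_X]
      exact hx k (Finset.mem_coe.mp hk)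
    have hz : (X 0 : A 4 K) ∈
        (AffineCoordBlowup.IΛ 4 K (insert 0 (Fin.succ '' (S'' : Set (Fin 4))))).map (θ : A 4 K →+* A 4 K) ⊔
          Ideal.span {(X l.succ : A 4 K)} := by
      have h1 := Ideal.mem_map_of_mem (θ : A 4 K →+* A 4 K)
        (Ideal.subset_span ⟨0, Set.mem_insert _ _, rfl⟩ :
          (X 0 : A 4 K) ∈ AffineCoordBlowup.IΛ 4 K (insert 0 (Fin.succ '' (S'' : Set (Fin 4)))))
      rw [RingHom.coe_coe, hθ0] at h1
      have h2 := Ideal.sub_mem _ (Ideal.mem_sup_left h1) hδ''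
      rwa [add_sub_cancel_right] at h2
    rw [AffineCoordBlowup.IΛ, Ideal.span_le]
    rintro _ ⟨m, hm, rfl⟩
    rcases hm with rfl | ⟨k, hk, rfl⟩
    · exact hz
    · exact hx k (Finset.mem_coe.mp hk)

/-! ## §2 The strict transform of `Y″` on the re-centred `x_l`-chart meets `x_l = 0` in `V(z, x_{S″}, x_l)` -/

/-- The composite of two `K`-automorphisms as a ring map. -/
theorem coe_trans_eq_comp (Ξ θ : A 4 K ≃ₐ[K] A 4 K) :
    ((Ξ.trans θ : A 4 K ≃ₐ[K] A 4 K) : A 4 K →+* A 4 K) = (θ : A 4 K →+* A 4 K).comp (Ξ : A 4 K →+* A 4 K) :=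
  RingHom.ext fun _ => rfl

/-- **`(θ ∘ Ξ)(J″^{st,l}) + (x_l) = (z, x_{S″}, x_l)`** (`j, l ∉ S″`, `j ≠ l`, `j, l ∈ S`). `Ξ` is E1's raw shear of the
`x_l`-chart for the centre `S″` (`Ξ z = z + τ H_l`, `Ξ|_{K[x]} = τ`, `τ x_l = x_l`, `τ x_j = x_j`, `τ xᵢ = xᵢ + bᵢ x_j`
(`i ∈ S″ ∩ S`), `τ x_k = x_k + b_k` (`k ∈ S″ ∖ S`)), so `Ξ(J″^{st,l}) = (z, x_{S″})` (E1); `θ` is a cleaning with root in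
`(x_{insert l S″})` (§1). -/
theorem map_shear_clean_coordStrictTransformIdeal_graph_sup (hj : j ∈ S) (hlS'' : l ∉ S'') (hjl : j ≠ l)
    (hΞ0 : Ξ (X 0) = X 0 + rename Fin.succ (τ g₀)) (hΞτ : ∀ i : Fin 4, Ξ (X i.succ) = rename Fin.succ (τ (X i)))
    (hτl : τ (X l) = X l) (hτj : τ (X j) = X j) (hτ1 : ∀ i ∈ S'' ∩ S, τ (X i) = X i + C (b i) * X j)
    (hτ2 : ∀ k ∈ S'' \ S, τ (X k) = X k + C (b k))
    {H : MvPolynomial (Fin 4) K} (hHl : coordBlowupSubst K (S : Set (Fin 4)) l H = X l * g₀)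
    (hθ0 : θ (X 0) = X 0 + rename Fin.succ δ) (hθs : ∀ i : Fin 4, θ (X i.succ) = X i.succ)
    (hδ : δ ∈ Ideal.span (X '' ((insert l S'' : Finset (Fin 4)) : Set (Fin 4)) : Set (MvPolynomial (Fin 4) K))) :
    (coordStrictTransformIdeal K (insert 0 (Fin.succ '' (S : Set (Fin 4)))) l.succ
      (Ideal.span (insert (X 0 - rename Fin.succ H)
        (((fun k : Fin 4 => (X k.succ - C (b k) : A 4 K)) '' ((S'' \ S : Finset (Fin 4)) : Set (Fin 4))) ∪
         ((fun i : Fin 4 => (X i.succ - C (b i) * X j.succ : A 4 K)) '' ((S'' ∩ S : Finset (Fin 4)) : Set (Fin 4))))))).map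
        ((Ξ.trans θ : A 4 K ≃ₐ[K] A 4 K) : A 4 K →+* A 4 K) ⊔ Ideal.span {(X l.succ : A 4 K)} =
      AffineCoordBlowup.IΛ 4 K (insert 0 (Fin.succ '' ((insert l S'' : Finset (Fin 4)) : Set (Fin 4)))) := by
  have hg : τ g₀ - τ g₀ ∈ Ideal.span (X '' (S'' : Set (Fin 4)) : Set (MvPolynomial (Fin 4) K)) := by
    rw [sub_self]; exact Ideal.zero_mem _
  rw [coe_trans_eq_comp, ← Ideal.map_map,
    map_shear_coordStrictTransformIdeal_graph hj hlS'' hjl hΞ0 hΞτ hτl hτj hτ1 hτ2 hHl hg,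
    map_clean_IΛ_sup_span_X hθ0 hθs hδ]

/-! ## §3 The cleaned composite is again a shear re-centring -/

/-- `(Ξ.trans θ) z = z + (τ g₀ + δ)`. -/
theorem trans_clean_X_zero (hΞ0 : Ξ (X 0) = X 0 + rename Fin.succ (τ g₀)) (hθ0 : θ (X 0) = X 0 + rename Fin.succ δ)
    (hθs : ∀ i : Fin 4, θ (X i.succ) = X i.succ) :
    (Ξ.trans θ) (X 0) = X 0 + rename Fin.succ (τ g₀ + δ) := by
  rw [AlgEquiv.trans_apply, hΞ0, map_add, hθ0, clean_rename hθs, map_add]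
  ring

/-- `(Ξ.trans θ) xᵢ = τ xᵢ`. -/
theorem trans_clean_X_succ (hΞτ : ∀ i : Fin 4, Ξ (X i.succ) = rename Fin.succ (τ (X i)))
    (hθs : ∀ i : Fin 4, θ (X i.succ) = X i.succ) (i : Fin 4) :
    (Ξ.trans θ) (X i.succ) = rename Fin.succ (τ (X i)) := by
  rw [AlgEquiv.trans_apply, hΞτ, clean_rename hθs]

/-! ## §4 The generic point of the chart-`j` image lies in every chart `x_l`, `l ∉ S'` -/

/-- **`x_l + c ∉ (z, x_{S'})` for `l ∉ S'`** (any constant `c`). -/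
theorem X_succ_add_C_not_mem_IΛ {S' : Finset (Fin 4)} (hlS' : l ∉ S') (c : K) :
    (X l.succ + C c : A 4 K) ∉ AffineCoordBlowup.IΛ 4 K (insert 0 (Fin.succ '' (S' : Set (Fin 4)))) := by
  classical
  by_cases hc : c = 0
  · rw [hc, C_0, add_zero]
    exact X_succ_not_mem_IΛ hlS'
  · intro hmem
    rw [AffineCoordBlowup.IΛ, mem_ideal_span_X_image] at hmem
    have h0 : (0 : Fin (4 + 1) →₀ ℕ) ∈ (X l.succ + C c : A 4 K).support := by
      rw [MvPolynomial.mem_support_iff, coeff_add, coeff_C, if_pos rfl, coeff_zero_X, zero_add]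
      exact hc
    obtain ⟨i, -, hi⟩ := hmem 0 h0
    exact hi rfl

end ChartDictionary

end Summit.ResolutionOfSingularities.ResolutionOfSingularities.Theorems.PIDim4

end
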